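import Summits.QuantumFields.YangMills.Theorems.SmallFieldWideningLargeFieldMassRefinementTailUnitTop
import Literature.MathematicalPhysics.QuantumFieldTheory.Balaban1983to89.T3RestrictedUnitDensity

/-!
# Route `SmallFieldWidening`, crux r3 `LargeFieldMassRefinementTail` (stmt-QuantumFields-22884), line `birth` v6 — THE UNIT-TOP TAIL IN
# BAŁABAN'S DENSITY CURRENCY: the Gibbs mass of the unit-top first-exit event IS `Z_K⁻¹ ∫_{large unit plaquette} ρ̂^{S}_K dV_{T₁}`, the
# large-plaquette part of the TERMINAL RESTRICTED DENSITY of the small sub-unit history `S` ([Balaban1985UV3] (70)–(71) shape)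
# (support file; width seat `ym-line-sfw-p2-w2` gen 17; the stub `stub_firstExitDeep`, both cruxes and rung R3 stay OPEN)

WHAT THIS IS NOT.  No estimate of Bałaban's programme is proved; nothing bears on the Yang–Mills mass gap; rung R3 (`YM3TorusSU2`) is a RECORD rung.
This file only IDENTIFIES the one open registered stub of cruxes stmt-QuantumFields-22884 / 26243 (in its unit-top normal form `UnitTop` of the
companion file `…UnitTop`, `LargeFieldMassRefinementTailUnitTop.deepStub_iff_unitTop`) with a statement about the objects the (α)/UV3 programme of the
tree types — Bałaban's renormalised densities — so that a density-level supplier discharges the stub with no measure theory left to do.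

* §1 `setOf_subUnitGood_eq_histGood_one` — the small SUB-UNIT history «`Ū^k` is `θ(K−k)`-small for all `k < K`» is the tree's UV-small-history event
  with ONE free top step, `histGood F ℰp θ K 1` ([Balaban1985UV3] (7) p.257).
* §2 ★ `gibbsK_real_unitTop_eq_integral_resUnitDensity` — for every run `K`, unit plaquette label `q` and threshold `t`:
  `Gibbs_K{ U ∈ histGood K 1 ∧ t ≤ |A_K U(∂q) − 1| } = Z_K⁻¹ · ∫_{ {u | t ≤ |u(∂q) − 1|} } ρ̂^{histGood K 1}_K(u) du`, where
  `ρ̂^S_K = T_{K−1}⋯T_0(1_S e^{−β_K A})` read on the unit labels is the tree's `T3RestrictedUnitDensity.resUnitDensity` and `A_K = unitShift ∘ avg^K` the unit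
  transport (`map_unitA_restrict_eq_withDensity` of the tree, evaluated on one measurable unit-field event); `integral_resUnitDensity_univ` — `∫ ρ̂^{univ}_K du = Z_K`.
* §3 ★ `unitTop_of_densityRatio` and the by-name certificates `largeFieldMassRefinementTail_of_densityRatio` (r3, stmt-QuantumFields-22884),
  `firstExitWindowTailL_of_densityRatio` (stmt-QuantumFields-26243), `historyTailL_of_densityRatio` (stmt-QuantumFields-19936): the stub — hence all three
  cruxes — follows from the (70)–(71)-SHAPED DENSITY RATIO BOUND
  `∀ L b₀ p₀ ∃ γ₁ C c N ∀ F (F.L = L) ∀ γ ∈ (0, γ₁] ∀ K ≥ 2 ∀ unit plaquette q: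
     ∫_{ θ_{b₀}(0) ≤ |u(∂q) − 1| } ρ̂^{histGood_{θ_{b₀}} K 1}_K du ≤ C·γ^{-N}·exp(−c·p_{b₀}(√γ)²) · ∫ ρ̂^{univ}_K du`
  — «the part of the terminal small-history effective density carried by ONE `p(√γ)`-large unit plaquette variable is exponentially small relative to the
  full terminal density», which is how [Balaban1985UV3] p.273 reads (70)–(71) («the function χ(…)exp(…) restricted to the large plaquette variables … can
  be estimated by exp(−c·p(g_k)²)») — printed there as a bound on densities inside the inductive representation (41), NOT as this volume-uniform ratio;
  the ratio is the open content (the small-field half of the programme: both integrals carry the same extensive constants, which must cancel).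

References: T. Bałaban, Commun. Math. Phys. **102** (1985) 255–275 [Balaban1985UV3] ((2) p.256, (6)–(7) p.257, (41) p.266, (70)–(71) p.273);
CMP **98** (1985) 17–51 [Balaban1985Averaging] ((10) p.19).
-/

noncomputable section

open MeasureTheory
open scoped ENNReal
open Literature.MathematicalPhysics.QuantumFieldTheory.Balaban1983to89
open Literature.MathematicalPhysics.QuantumFieldTheory.Balaban1983to89.Missing
open Literature.MathematicalPhysics.QuantumFieldTheory.Balaban1983to89.T3ContinuumYM3Torus
open Literature.MathematicalPhysics.QuantumFieldTheory.Balaban1983to89.T3UnitScaleTilt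
open Literature.MathematicalPhysics.QuantumFieldTheory.Balaban1983to89.T3UnitLawDensityEML (ℰp measurableE_ℰp)
open Literature.MathematicalPhysics.QuantumFieldTheory.Balaban1983to89.T3LevelShift
open Literature.MathematicalPhysics.QuantumFieldTheory.Balaban1983to89.T3RestrictedUnitDensity
open Literature.MathematicalPhysics.QuantumFieldTheory.Balaban1983to89.T4Continuum (measurable_iter)

namespace Summit.QuantumFields.YangMills.Theorems.LargeFieldMassRefinementTailUnitTopDensity

/-! ## §1 The small sub-unit history is `histGood … K 1` -/

section Events

variable (F : T3Family) (θ : ℕ → ℝ) (K : ℕ)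

/-- The small SUB-UNIT history of run `K` («every block field strictly below the unit lattice is small at its height») is Bałaban's UV-small-history
event with ONE free top step. [cite: Balaban1985UV3, (7) p.257] -/
theorem setOf_subUnitGood_eq_histGood_one :
    {U : GaugeField (F.P K) 0 (Matrix.specialUnitaryGroup (Fin 2) ℂ) | ∀ k, k < K →
        PlaqSmall (θ (K - k)) (Averaging.iter (fun i => BlockAveraging.blockAvg (P := F.P K) (j := i) ℰp) k U)} =
      histGood F ℰp θ K 1 := by
  ext U
  simp only [histGood, Set.mem_setOf_eq]
  exact ⟨fun h j hj => h j (by omega), fun h k hk => h k (by omega)⟩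

/-- The unit-top event is «small sub-unit history» ∩ «the unit transport `A_K U` has a `t`-large plaquette at the label `q`»: for a unit plaquette `p`
of run `K` and its label `q = plaqShift⁻¹ p`, `|Ū^K(∂p) − 1| = |(A_K U)(∂q) − 1|`. [cite: Balaban1987RG1, (0.4)/(0.11) p.253] -/
theorem setOf_unitTop_eq_inter_preimage (t : ℝ) (p : Plaq (F.P K) K) :
    {U : GaugeField (F.P K) 0 (Matrix.specialUnitaryGroup (Fin 2) ℂ) | (∀ k, k < K →
        PlaqSmall (θ (K - k)) (Averaging.iter (fun i => BlockAveraging.blockAvg (P := F.P K) (j := i) ℰp) k U)) ∧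
        t ≤ GaugeGroup.dist1 (GaugeField.plaqHol (Averaging.iter (fun i => BlockAveraging.blockAvg (P := F.P K) (j := i) ℰp) K U) p)} =
      unitA F ℰp K ⁻¹' {u | t ≤ GaugeGroup.dist1 (GaugeField.plaqHol u ((plaqShift (F.sitesPerDir_unit K)).symm p))} ∩
        histGood F ℰp θ K 1 := by
  rw [← setOf_subUnitGood_eq_histGood_one]
  ext U
  simp only [Set.mem_inter_iff, Set.mem_preimage, Set.mem_setOf_eq]
  have hhol : GaugeField.plaqHol (unitA F ℰp K U) ((plaqShift (F.sitesPerDir_unit K)).symm p) =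
      GaugeField.plaqHol (Averaging.iter (fun i => BlockAveraging.blockAvg (P := F.P K) (j := i) ℰp) K U) p := by
    show GaugeField.plaqHol (fieldShift (F.sitesPerDir_unit K) _) _ = _
    rw [plaqHol_fieldShift, Equiv.apply_symm_apply]
    rfl
  rw [hhol]
  exact and_comm

/-- The large-plaquette event of a unit label is measurable. [folklore] -/
theorem measurableSet_largePlaq (t : ℝ) (q : Plaq (F.P 0) 0) :
    MeasurableSet {u : GaugeField (F.P 0) 0 (Matrix.specialUnitaryGroup (Fin 2) ℂ) | t ≤ GaugeGroup.dist1 (GaugeField.plaqHol u q)} :=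
  measurableSet_le measurable_const (RegularGaugeGroup.measurable_dist1.comp (measurable_plaqHol q))

end Events

/-! ## §2 The unit-top mass is the large-plaquette part of the terminal restricted density -/

section Density

variable (F : T3Family) {γ : ℝ} (K : ℕ)

/-- **`∫ ρ̂^{univ}_K du = Z_K`**: the unrestricted terminal density integrates to the partition function ((2)/(6) with the test function `1`, then the
unit relabelling `unitShift`, which preserves product Haar). [cite: Balaban1985UV3, (2) p.256 and (6) p.257] -/
theorem integral_resUnitDensity_univ (hγ : 0 ≤ γ) :
    ∫ u, resUnitDensity F γ K Set.univ u ∂fieldMeasure (F.P 0) 0 (Matrix.specialUnitaryGroup (Fin 2) ℂ) =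
      partitionFn (G := Matrix.specialUnitaryGroup (Fin 2) ℂ) (F.P K) ((F.scheme ℰp γ).β K) := by
  have hcv : ∫ u, resUnitDensity F γ K Set.univ u ∂fieldMeasure (F.P 0) 0 (Matrix.specialUnitaryGroup (Fin 2) ℂ) =
      ∫ V, resUnitDensity F γ K Set.univ (unitShift F K V) ∂fieldMeasure (F.P K) K (Matrix.specialUnitaryGroup (Fin 2) ℂ) :=
    (integral_comp_fieldShift (F.sitesPerDir_unit K) (fun u => resUnitDensity F γ K Set.univ u)).symm
  rw [hcv]
  simp_rw [resUnitDensity_unitShift]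
  have key := integral_resDensity_mul F K (S := Set.univ) MeasurableSet.univ hγ (Nat.le_add_left K F.m) (fun _ => (1 : ℝ))
    measurable_const ⟨1, fun _ => by simp⟩
  simp only [mul_one, Set.indicator_univ] at key
  rw [key]
  rfl

/-- ★ **THE UNIT-TOP MASS IN THE DENSITY CURRENCY**: for every run `K`, threshold profile `θ`, threshold `t` and unit plaquette `p` of run `K` (label
`q = plaqShift⁻¹ p`), `Gibbs_K{ small sub-unit history ∧ t ≤ |Ū^K(∂p) − 1| } = Z_K⁻¹ · ∫_{ {u | t ≤ |u(∂q) − 1|} } ρ̂^{histGood K 1}_K(u) du` — the tree's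
`map_unitA_restrict_eq_withDensity` («`(A_K)_*(Gibbs_K|S) = dV_{T₁}.withDensity(Z_K⁻¹ρ̂^S_K)`») evaluated on one measurable unit-field event.
[cite: Balaban1985UV3, (2) p.256, (6)-(7) p.257 and (70)-(71) p.273] -/
theorem gibbsK_real_unitTop_eq_integral_resUnitDensity (hγ : 0 ≤ γ) (θ : ℕ → ℝ) (t : ℝ) (p : Plaq (F.P K) K) :
    (gibbsK F ℰp γ K).real {U | (∀ k, k < K →
        PlaqSmall (θ (K - k)) (Averaging.iter (fun i => BlockAveraging.blockAvg (P := F.P K) (j := i) ℰp) k U)) ∧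
        t ≤ GaugeGroup.dist1 (GaugeField.plaqHol (Averaging.iter (fun i => BlockAveraging.blockAvg (P := F.P K) (j := i) ℰp) K U) p)} =
      (partitionFn (G := Matrix.specialUnitaryGroup (Fin 2) ℂ) (F.P K) ((F.scheme ℰp γ).β K))⁻¹ *
        ∫ u in {u | t ≤ GaugeGroup.dist1 (GaugeField.plaqHol u ((plaqShift (F.sitesPerDir_unit K)).symm p))},
          resUnitDensity F γ K (histGood F ℰp θ K 1) u ∂fieldMeasure (F.P 0) 0 (Matrix.specialUnitaryGroup (Fin 2) ℂ) := by
  set S := histGood (G := Matrix.specialUnitaryGroup (Fin 2) ℂ) F ℰp θ K 1 with hSdef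
  set E := {u : GaugeField (F.P 0) 0 (Matrix.specialUnitaryGroup (Fin 2) ℂ) |
    t ≤ GaugeGroup.dist1 (GaugeField.plaqHol u ((plaqShift (F.sitesPerDir_unit K)).symm p))} with hEdef
  have hS : MeasurableSet S := measurableSet_histGood F ℰp measurableE_ℰp θ K 1
  have hE : MeasurableSet E := measurableSet_largePlaq F t _
  set Z := partitionFn (G := Matrix.specialUnitaryGroup (Fin 2) ℂ) (F.P K) ((F.scheme ℰp γ).β K) with hZdef
  have hZ : 0 < Z := partitionFn_pos' _ (F.scheme_β_nonneg ℰp hγ K)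
  obtain ⟨hdm, hdi⟩ := resUnitDensity_props F K hS hγ
  have hd0 := resUnitDensity_nonneg F γ K S
  -- the event as «preimage under the unit transport» ∩ «small sub-unit history»
  rw [setOf_unitTop_eq_inter_preimage F θ K t p]
  -- `Gibbs_K(A_K⁻¹ E ∩ S) = ((Gibbs_K|S).map A_K)(E) = (dV.withDensity (Z⁻¹ρ̂^S))(E)`
  have h1 : (gibbsK F ℰp γ K) (unitA F ℰp K ⁻¹' E ∩ S) = (Measure.map (unitA F ℰp K) ((gibbsK F ℰp γ K).restrict S)) E := by
    rw [Measure.map_apply (measurable_unitA F ℰp measurableE_ℰp K) hE, Measure.restrict_apply ((measurable_unitA F ℰp measurableE_ℰp K) hE)]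
  rw [measureReal_def, h1, map_unitA_restrict_eq_withDensity F K hS hγ, withDensity_apply _ hE]
  -- `(∫⁻_E ofReal(Z⁻¹ρ̂^S)).toReal = ∫_E Z⁻¹ρ̂^S = Z⁻¹ ∫_E ρ̂^S`
  have hint : IntegrableOn (fun u => Z⁻¹ * resUnitDensity F γ K S u) E
      (fieldMeasure (F.P 0) 0 (Matrix.specialUnitaryGroup (Fin 2) ℂ)) := (hdi.const_mul _).integrableOn
  have hnn : 0 ≤ᵐ[(fieldMeasure (F.P 0) 0 (Matrix.specialUnitaryGroup (Fin 2) ℂ)).restrict E]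
      fun u => Z⁻¹ * resUnitDensity F γ K S u :=
    Filter.Eventually.of_forall fun u => mul_nonneg (inv_nonneg.mpr hZ.le) (hd0 u)
  rw [← ofReal_integral_eq_lintegral_ofReal hint hnn, ENNReal.toReal_ofReal (integral_nonneg fun u =>
    mul_nonneg (inv_nonneg.mpr hZ.le) (hd0 u)), integral_const_mul]

end Density

/-! ## §3 The stub and the three cruxes from a (70)–(71)-shaped density ratio bound -/

section Ratio

/-- ★ **UNIT-TOP ⇐ THE DENSITY RATIO BOUND**: if for every `L, b₀, p₀` there are `γ₁ ∈ (0,1]`, `C ≥ 0`, `c > 0`, `N` such that for every family `F`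
(`F.L = L`), every `0 < γ ≤ γ₁`, every run `K ≥ 2` and every unit plaquette label `q`, the part of the terminal restricted density of the small sub-unit
history carried by «`θ_{b₀}(0) ≤ |u(∂q) − 1|`» is at most `C·γ^{-N}·exp(−c·p_{b₀}(√γ)²)` times the full terminal density's integral `∫ρ̂^{univ}_K = Z_K`, then
the unit-top tail `UnitTop` (the normal form of `stub_firstExitDeep`) holds with the same constants. [cite: Balaban1985UV3, (41) p.266 and (70)-(71) p.273] -/
theorem unitTop_of_densityRatio
    (hR : ∀ (L : ℕ) (b₀ p₀ : ℝ), 0 < b₀ → 2 < p₀ → ∃ (γ₁ C c : ℝ) (N : ℕ), 0 < γ₁ ∧ γ₁ ≤ 1 ∧ 0 < c ∧ 0 ≤ C ∧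
      ∀ (F : T3Family) (γ : ℝ), F.L = L → 0 < γ → γ ≤ γ₁ → ∀ (K : ℕ), 2 ≤ K → ∀ q : Plaq (F.P 0) 0,
        ∫ u in {u | θBal F.L γ b₀ p₀ 0 ≤ GaugeGroup.dist1 (GaugeField.plaqHol u q)},
            resUnitDensity F γ K (histGood F ℰp (θBal F.L γ b₀ p₀) K 1) u ∂fieldMeasure (F.P 0) 0 (Matrix.specialUnitaryGroup (Fin 2) ℂ) ≤
          C * (γ⁻¹) ^ N * Real.exp (-(c * B10.pFun b₀ p₀ (Real.sqrt γ) ^ 2)) *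
            ∫ u, resUnitDensity F γ K Set.univ u ∂fieldMeasure (F.P 0) 0 (Matrix.specialUnitaryGroup (Fin 2) ℂ)) :
    ∀ (L : ℕ) (b₀ p₀ : ℝ), 0 < b₀ → 2 < p₀ → ∃ (γ₁ C c : ℝ) (N : ℕ), 0 < γ₁ ∧ γ₁ ≤ 1 ∧ 0 < c ∧ 0 ≤ C ∧
      ∀ (F : T3Family) (γ : ℝ), F.L = L → 0 < γ → γ ≤ γ₁ → ∀ (K : ℕ), 2 ≤ K → ∀ p : Plaq (F.P K) K,
        (gibbsK F ℰp γ K).real {U | (∀ k, k < K → PlaqSmall (θBal F.L γ b₀ p₀ (K - k))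
            (Averaging.iter (fun i => BlockAveraging.blockAvg (P := F.P K) (j := i) ℰp) k U)) ∧
          θBal F.L γ b₀ p₀ 0 ≤ GaugeGroup.dist1 (GaugeField.plaqHol
            (Averaging.iter (fun i => BlockAveraging.blockAvg (P := F.P K) (j := i) ℰp) K U) p)} ≤
        C * (γ⁻¹) ^ N * Real.exp (-(c * B10.pFun b₀ p₀ (Real.sqrt γ) ^ 2)) := by
  intro L b₀ p₀ hb₀ hp₀
  obtain ⟨γ₁, C, c, N, hγ₁, hγ₁1, hc, hC, h⟩ := hR L b₀ p₀ hb₀ hp₀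
  refine ⟨γ₁, C, c, N, hγ₁, hγ₁1, hc, hC, fun F γ hFL hγ hle K hK p => ?_⟩
  have hZ : 0 < partitionFn (G := Matrix.specialUnitaryGroup (Fin 2) ℂ) (F.P K) ((F.scheme ℰp γ).β K) :=
    partitionFn_pos' _ (F.scheme_β_nonneg ℰp hγ.le K)
  have happ := h F γ hFL hγ hle K hK ((plaqShift (F.sitesPerDir_unit K)).symm p)
  rw [integral_resUnitDensity_univ F K hγ.le] at happ
  rw [gibbsK_real_unitTop_eq_integral_resUnitDensity F K hγ.le (θBal F.L γ b₀ p₀) (θBal F.L γ b₀ p₀ 0) p, inv_mul_le_iff₀ hZ]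
  calc _ ≤ _ := happ
    _ = _ := by ring

/-- **r3 `LargeFieldMassRefinementTail` (stmt-QuantumFields-22884) ⇐ THE DENSITY RATIO BOUND** (via `unitTop_of_densityRatio` and the companion file's
`largeFieldMassRefinementTail_of_unitTop`).  Conditional certificate; nothing about the mass gap. [cite: Balaban1985UV3, (70)-(71) p.273] -/
theorem largeFieldMassRefinementTail_of_densityRatio
    (hR : ∀ (L : ℕ) (b₀ p₀ : ℝ), 0 < b₀ → 2 < p₀ → ∃ (γ₁ C c : ℝ) (N : ℕ), 0 < γ₁ ∧ γ₁ ≤ 1 ∧ 0 < c ∧ 0 ≤ C ∧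
      ∀ (F : T3Family) (γ : ℝ), F.L = L → 0 < γ → γ ≤ γ₁ → ∀ (K : ℕ), 2 ≤ K → ∀ q : Plaq (F.P 0) 0,
        ∫ u in {u | θBal F.L γ b₀ p₀ 0 ≤ GaugeGroup.dist1 (GaugeField.plaqHol u q)},
            resUnitDensity F γ K (histGood F ℰp (θBal F.L γ b₀ p₀) K 1) u ∂fieldMeasure (F.P 0) 0 (Matrix.specialUnitaryGroup (Fin 2) ℂ) ≤
          C * (γ⁻¹) ^ N * Real.exp (-(c * B10.pFun b₀ p₀ (Real.sqrt γ) ^ 2)) *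
            ∫ u, resUnitDensity F γ K Set.univ u ∂fieldMeasure (F.P 0) 0 (Matrix.specialUnitaryGroup (Fin 2) ℂ)) :
    Summit.QuantumFields.YangMills.Theses.SmallFieldWidening.LargeFieldMassRefinementTail :=
  LargeFieldMassRefinementTailUnitTop.largeFieldMassRefinementTail_of_unitTop (unitTop_of_densityRatio hR)

/-- **`FirstExitWindowTailL` (stmt-QuantumFields-26243) ⇐ THE DENSITY RATIO BOUND.**  Conditional certificate; nothing about the mass gap.
[cite: Balaban1985UV3, (70)-(71) p.273] -/
theorem firstExitWindowTailL_of_densityRatio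
    (hR : ∀ (L : ℕ) (b₀ p₀ : ℝ), 0 < b₀ → 2 < p₀ → ∃ (γ₁ C c : ℝ) (N : ℕ), 0 < γ₁ ∧ γ₁ ≤ 1 ∧ 0 < c ∧ 0 ≤ C ∧
      ∀ (F : T3Family) (γ : ℝ), F.L = L → 0 < γ → γ ≤ γ₁ → ∀ (K : ℕ), 2 ≤ K → ∀ q : Plaq (F.P 0) 0,
        ∫ u in {u | θBal F.L γ b₀ p₀ 0 ≤ GaugeGroup.dist1 (GaugeField.plaqHol u q)},
            resUnitDensity F γ K (histGood F ℰp (θBal F.L γ b₀ p₀) K 1) u ∂fieldMeasure (F.P 0) 0 (Matrix.specialUnitaryGroup (Fin 2) ℂ) ≤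
          C * (γ⁻¹) ^ N * Real.exp (-(c * B10.pFun b₀ p₀ (Real.sqrt γ) ^ 2)) *
            ∫ u, resUnitDensity F γ K Set.univ u ∂fieldMeasure (F.P 0) 0 (Matrix.specialUnitaryGroup (Fin 2) ℂ)) :
    Summit.QuantumFields.YangMills.Theses.FirstExitWindow.FirstExitWindowTailL :=
  LargeFieldMassRefinementTailUnitTop.firstExitWindowTailL_of_unitTop (unitTop_of_densityRatio hR)

/-- **K2′ `HistoryTailL` (stmt-QuantumFields-19936) ⇐ THE DENSITY RATIO BOUND.**  Conditional certificate; nothing about the mass gap.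
[cite: Balaban1985UV3, (70)-(71) p.273] -/
theorem historyTailL_of_densityRatio
    (hR : ∀ (L : ℕ) (b₀ p₀ : ℝ), 0 < b₀ → 2 < p₀ → ∃ (γ₁ C c : ℝ) (N : ℕ), 0 < γ₁ ∧ γ₁ ≤ 1 ∧ 0 < c ∧ 0 ≤ C ∧
      ∀ (F : T3Family) (γ : ℝ), F.L = L → 0 < γ → γ ≤ γ₁ → ∀ (K : ℕ), 2 ≤ K → ∀ q : Plaq (F.P 0) 0,
        ∫ u in {u | θBal F.L γ b₀ p₀ 0 ≤ GaugeGroup.dist1 (GaugeField.plaqHol u q)},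
            resUnitDensity F γ K (histGood F ℰp (θBal F.L γ b₀ p₀) K 1) u ∂fieldMeasure (F.P 0) 0 (Matrix.specialUnitaryGroup (Fin 2) ℂ) ≤
          C * (γ⁻¹) ^ N * Real.exp (-(c * B10.pFun b₀ p₀ (Real.sqrt γ) ^ 2)) *
            ∫ u, resUnitDensity F γ K Set.univ u ∂fieldMeasure (F.P 0) 0 (Matrix.specialUnitaryGroup (Fin 2) ℂ)) :
    Summit.QuantumFields.YangMills.Theses.UnitScaleTilt.HistoryTailL :=
  LargeFieldMassRefinementTailUnitTop.historyTailL_of_unitTop (unitTop_of_densityRatio hR)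

end Ratio

end Summit.QuantumFields.YangMills.Theorems.LargeFieldMassRefinementTailUnitTopDensity

end
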